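import Summits.CriticalPhenomena.PercolationContinuityZ3.Theorems.PercNearOneGluingNearOneGluingKnLemma3i
import Summits.CriticalPhenomena.PercolationContinuityZ3.Theorems.PercNearOneGluingNearOneGluingPivotalityDomination
import Summits.CriticalPhenomena.PercolationContinuityZ3.Theorems.PercNearOneGluingAdditiveGluingBhkSets
import Literature.Probability.Percolation.PercolationEvents
import Literature.Probability.LatticeModels.ProdBernoulliIndependence

/-!
# Crux `PercNearOneGluing.NearOneGluing` (stmt-CriticalPhenomena-4574), line `SketchR2I5` —
# Kozma–Nitzan Question 7 for THREE relays, part I: the decomposition and the two brackets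

Lead prover-line-stmt-CriticalPhenomena-4574-c6 (cycle 6).  Lands `--supports stmt-CriticalPhenomena-4574`;
no definitions, no named facts.

## Content

Finite weighted graph on `Fin n` (`μ = prodBernoulli w`), source `o`, target `b`, relays `x, y, z` with `z` the
least reliable (`μ(z ↔ b) ≤ μ(y ↔ b)`).  Kozma–Nitzan's Question 7 (arXiv:2401.12397, p. 36) for `A = {x, y, z}`
asks whether `μ(o ↔ b, o ↔ A) ≥ μ(o ↔ A, z ↔ b)`; it implies Conjecture 1 for `|A| = 3`, open in the paper
(Thms 2, 3 are special cases).  We prove: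

* `q7Three_decomp` (exact decomposition): with `D = {x ↮ y} ∩ {x ↮ z}`,
  `μ(o↔b, o↔A) − μ(z↔b, o↔A) ≥ [μ(o↔y, y↔b, z↮b) − μ(o↔y, z↔b, y↮b)] + [μ(D, o↔x, x↔b) − μ(D, o↔x, z↔b)]`
  (the two subtracted events are disjoint pieces of `{z↔b, o↔A}`, the two added ones of `{o↔b, o↔A}`, and what
  is left of `{z ↔ b, o ↔ A}` is contained in what is left of `{o ↔ b, o ↔ A}`);
* the first bracket is `≥ 0` by Kozma–Nitzan's Lemma 3(i) (`knLemma3i`, `Q = {o ↔ y}`) — `q7Three_lemma3`;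
* `q7Three_bhk` (van den Berg–Häggström–Kahn, Thms 1.3–1.4 for the source `x` and the SET `{y, z}`, tree
  theorem `stub_bhkSets`): `μ(D∩{o↔x})·μ(D∩{x↔b}) ≤ μ(D)·μ(D∩{o↔x}∩{x↔b})` and
  `μ(D)·μ(D∩{o↔x}∩{z↔b}) ≤ μ(D∩{o↔x})·μ(D∩{z↔b})`;
* hence `q7Three_of_R3`: Question 7 for three relays follows from the inequality
  `(R3)  μ(D)·[μ(o↔y, y↔b, z↮b) − μ(o↔y, z↔b, y↮b)] + μ(D, o↔x)·[μ(D, x↔b) − μ(D, z↔b)] ≥ 0`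
  (lead c6: 0 violations in ≈ 4 000 exact instances incl. adversarial search; OPEN), and unconditionally in the
  CUT CASE `μ(D, z↔b) ≤ μ(D, x↔b)` (`q7Three_of_cut`: "cut off from `y` and `z`, the relay `x` still beats `z`")
  and in the SOURCE-RELIABLE case `μ(z↔b) ≤ μ(o↔b)` (`q7Three_of_source`, Lemma 3(i) with `a₂ = o`), with the
  Conjecture-1 corollary `conjOneThree_of_cut` (Harris).
[cite: KozmaNitzan2024, Question 7 (p. 36), Lemma 3(i) (pp. 6–7), Conjecture 1 (p. 3)]
[cite: VandenbergHaggstromKahn2005, Thms 1.3–1.4]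
-/

namespace Summit.CriticalPhenomena.PercolationContinuityZ3.Theorems

open MeasureTheory Set Literature.Probability.LatticeModels Literature.Probability.Percolation
open scoped Classical BigOperators

noncomputable section

namespace Q7ThreeCut

variable {V : Type*}

/-! ### Combinatorial helpers -/

/-- Transitivity of `↔`. [folklore] -/
theorem conn_trans {ω : BondConfig V} {a c d : V} (h1 : ω ∈ (openConn a c : Set (BondConfig V)))
    (h2 : ω ∈ (openConn c d : Set (BondConfig V))) : ω ∈ (openConn a d : Set (BondConfig V)) :=
  SimpleGraph.Reachable.trans h1 h2

/-- Symmetry of `↔` on members. [folklore] -/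
theorem conn_symm {ω : BondConfig V} {a c : V} (h : ω ∈ (openConn a c : Set (BondConfig V))) :
    ω ∈ (openConn c a : Set (BondConfig V)) :=
  SimpleGraph.Reachable.symm h

/-- **Connection from `s` is read off any edge set between `C_s` and `ω`**: if
`C_s(ω) ⊆ E ⊆ ω` then `E ∈ {s ↔ a} ↔ ω ∈ {s ↔ a}` (an open path from `s` uses only pairs of `C_s`).
[cite: VandenbergHaggstromKahn2005, §1 p. 3 (events defined on the cluster)] -/
theorem mem_openConn_iff_of_cluster_subset {ω E : BondConfig V} {s a : V}
    (hE : openEdgeCluster ω s ⊆ E) (hEω : E ⊆ ω) :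
    E ∈ (openConn s a : Set (BondConfig V)) ↔ ω ∈ (openConn s a : Set (BondConfig V)) := by
  constructor
  · intro h
    exact isUpperSet_openConn s a hEω h
  · intro h
    -- induction along the reflexive-transitive closure from `s`: every pair used lies in `C_s(ω) ⊆ E`
    have h' : Relation.ReflTransGen (openGraph ω).Adj s a := (SimpleGraph.reachable_iff_reflTransGen _ _).1 h
    have key : ∀ v : V, Relation.ReflTransGen (openGraph ω).Adj s v → (openGraph E).Reachable s v := by
      intro v hv
      induction hv with
      | refl => exact SimpleGraph.Reachable.refl _
      | tail hsc hcd ih =>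
        rename_i c d
        have hsc' : (openGraph ω).Reachable s c := (SimpleGraph.reachable_iff_reflTransGen _ _).2 hsc
        have hsd' : (openGraph ω).Reachable s d := hsc'.trans ⟨SimpleGraph.Walk.cons hcd .nil⟩
        have hmem : s(c, d) ∈ ω ∧ c ≠ d := (openGraph_adj ω c d).1 hcd
        have hC : s(c, d) ∈ openEdgeCluster ω s := by
          refine (mem_openEdgeCluster_iff ω s _).2 ⟨hmem.1, ?_, ?_⟩
          · rw [Sym2.mk_isDiag_iff]
            exact hmem.2
          · intro v hv
            rcases Sym2.mem_iff.1 hv with rfl | rfl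
            · exact hsc'
            · exact hsd'
        have hadjE : (openGraph E).Adj c d := by
          rw [openGraph_adj]
          exact ⟨hE hC, hmem.2⟩
        exact ih.trans ⟨SimpleGraph.Walk.cons hadjE .nil⟩
    exact key a h'

/-- The indicator of an increasing event, as a function of configurations, is monotone. [folklore] -/
theorem monotone_indicator_of_isUpperSet {A : Set (BondConfig V)} (hA : IsUpperSet A) :
    Monotone (A.indicator (1 : BondConfig V → ℝ)) := by
  intro C C' hCC'
  by_cases hC : C ∈ A
  · rw [indicator_of_mem hC, indicator_of_mem (hA hCC' hC)]
    simp only [Pi.one_apply, le_refl]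
  · rw [indicator_of_notMem hC]
    exact indicator_nonneg (fun _ _ => zero_le_one) _

/-- The indicator of `{s ↔ a}` evaluated at an edge set `E` with `C_s(ω) ⊆ E ⊆ ω` equals its value at `ω`.
[folklore] -/
theorem indicator_openConn_of_cluster_subset {ω E : BondConfig V} {s a : V}
    (hE : openEdgeCluster ω s ⊆ E) (hEω : E ⊆ ω) :
    (openConn s a : Set (BondConfig V)).indicator (1 : BondConfig V → ℝ) E =
      (openConn s a : Set (BondConfig V)).indicator (1 : BondConfig V → ℝ) ω := by
  by_cases h : ω ∈ (openConn s a : Set (BondConfig V))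
  · rw [indicator_of_mem h, indicator_of_mem ((mem_openConn_iff_of_cluster_subset hE hEω).2 h)]
    simp only [Pi.one_apply]
  · rw [indicator_of_notMem h, indicator_of_notMem (fun h' => h ((mem_openConn_iff_of_cluster_subset hE hEω).1 h'))]

variable [Fintype V]

/-- The integral over `D` of the indicator of an event is the measure of the intersection. [folklore] -/
theorem setIntegral_indicator_one_eq (μ : Measure (BondConfig V)) [IsFiniteMeasure μ]
    (D A : Set (BondConfig V)) :
    ∫ ω in D, A.indicator (1 : BondConfig V → ℝ) ω ∂μ = μ.real (D ∩ A) := by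
  rw [setIntegral_indicator (MeasurableSet.of_discrete : MeasurableSet A)]
  simp only [Pi.one_apply, setIntegral_const, smul_eq_mul, mul_one]

end Q7ThreeCut

open Q7ThreeCut

variable {n : ℕ}

/-! ### The exact decomposition -/

/-- **Decomposition of the Question-7 slack for three relays.**  With `D = {x ↮ y} ∩ {x ↮ z}` and
`oA = {o↔x} ∪ {o↔y} ∪ {o↔z}`:
`μ(o↔b ∩ oA) − μ(z↔b ∩ oA) ≥ [μ({o↔y} ∩ ({y↔b} ∖ {z↔b})) − μ({o↔y} ∩ ({z↔b} ∖ {y↔b}))]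
  + [μ(D ∩ {o↔x} ∩ {x↔b}) − μ(D ∩ {o↔x} ∩ {z↔b})]`
(in fact an identity; the inequality is what is used).  Proof: the events `S₂ = {o↔y, z↔b, y↮b}` and
`U₂ = D ∩ {o↔x, z↔b}` are disjoint pieces of `{z↔b} ∩ oA`, the events `S₁ = {o↔y, y↔b, z↮b}`,
`U₁ = D ∩ {o↔x, x↔b}` disjoint pieces of `{o↔b} ∩ oA`, and `({z↔b} ∩ oA) ∖ (S₂ ∪ U₂) ⊆ ({o↔b} ∩ oA) ∖ (S₁ ∪ U₁)`
(case analysis: on the left `o ↔ y` forces `y ↔ b`, and `o ↔ x, o ↮ y` forces `x ↔ z ↔ b`).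
[cite: KozmaNitzan2024, Question 7 (p. 36)] -/
theorem q7Three_decomp (w : Sym2 (Fin n) → unitInterval) (o b x y z : Fin n) :
    ((prodBernoulli w).real (openConn o y ∩ (openConn y b \ openConn z b)) -
        (prodBernoulli w).real (openConn o y ∩ (openConn z b \ openConn y b))) +
      ((prodBernoulli w).real (((openConn x y)ᶜ ∩ (openConn x z)ᶜ) ∩ openConn o x ∩ openConn x b) -
        (prodBernoulli w).real (((openConn x y)ᶜ ∩ (openConn x z)ᶜ) ∩ openConn o x ∩ openConn z b)) ≤
    (prodBernoulli w).real (openConn o b ∩ (openConn o x ∪ openConn o y ∪ openConn o z)) -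
      (prodBernoulli w).real (openConn z b ∩ (openConn o x ∪ openConn o y ∪ openConn o z)) := by
  set μ := prodBernoulli w with hμ
  set D : Set (BondConfig (Fin n)) := (openConn x y)ᶜ ∩ (openConn x z)ᶜ with hD
  set oA : Set (BondConfig (Fin n)) := openConn o x ∪ openConn o y ∪ openConn o z with hoA
  set S₁ : Set (BondConfig (Fin n)) := openConn o y ∩ (openConn y b \ openConn z b) with hS₁
  set S₂ : Set (BondConfig (Fin n)) := openConn o y ∩ (openConn z b \ openConn y b) with hS₂
  set U₁ : Set (BondConfig (Fin n)) := D ∩ openConn o x ∩ openConn x b with hU₁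
  set U₂ : Set (BondConfig (Fin n)) := D ∩ openConn o x ∩ openConn z b with hU₂
  set Lo : Set (BondConfig (Fin n)) := openConn o b ∩ oA with hLo
  set Lz : Set (BondConfig (Fin n)) := openConn z b ∩ oA with hLz
  -- inclusions
  have hS₁Lo : S₁ ⊆ Lo := by
    rintro ω ⟨hoy, hyb, -⟩
    exact ⟨conn_trans hoy hyb, Or.inl (Or.inr hoy)⟩
  have hU₁Lo : U₁ ⊆ Lo := by
    rintro ω ⟨⟨-, hox⟩, hxb⟩
    exact ⟨conn_trans hox hxb, Or.inl (Or.inl hox)⟩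
  have hS₂Lz : S₂ ⊆ Lz := by
    rintro ω ⟨hoy, hzb, -⟩
    exact ⟨hzb, Or.inl (Or.inr hoy)⟩
  have hU₂Lz : U₂ ⊆ Lz := by
    rintro ω ⟨⟨-, hox⟩, hzb⟩
    exact ⟨hzb, Or.inl (Or.inl hox)⟩
  -- disjointness
  have hdisj₁ : Disjoint S₁ U₁ := by
    rw [Set.disjoint_left]
    rintro ω ⟨hoy, -, -⟩ ⟨⟨⟨hxy, -⟩, hox⟩, -⟩
    exact hxy (conn_trans (conn_symm hox) hoy)
  have hdisj₂ : Disjoint S₂ U₂ := by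
    rw [Set.disjoint_left]
    rintro ω ⟨hoy, -, -⟩ ⟨⟨⟨hxy, -⟩, hox⟩, -⟩
    exact hxy (conn_trans (conn_symm hox) hoy)
  -- the key inclusion of the remainders
  have hrest : Lz \ (S₂ ∪ U₂) ⊆ Lo \ (S₁ ∪ U₁) := by
    rintro ω ⟨⟨hzb, hoA'⟩, hnot⟩
    simp only [mem_union, not_or] at hnot
    obtain ⟨hnS₂, hnU₂⟩ := hnot
    by_cases hoy : ω ∈ (openConn o y : Set (BondConfig (Fin n)))
    · -- `o ↔ y`: then `y ↔ b` (else `ω ∈ S₂`), so `o ↔ b`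
      have hyb : ω ∈ (openConn y b : Set (BondConfig (Fin n))) := by
        by_contra hyb
        exact hnS₂ ⟨hoy, hzb, hyb⟩
      refine ⟨⟨conn_trans hoy hyb, hoA'⟩, ?_⟩
      simp only [mem_union, not_or]
      refine ⟨fun h => h.2.2 hzb, fun h => ?_⟩
      exact h.1.1.1 (conn_trans (conn_symm h.1.2) hoy)
    · by_cases hox : ω ∈ (openConn o x : Set (BondConfig (Fin n)))
      · -- `o ↔ x`, `o ↮ y`: then `x ↮ y`, and `¬ U₂` forces `x ↔ z`, so `x ↔ b`
        have hxy : ω ∉ (openConn x y : Set (BondConfig (Fin n))) :=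
          fun h => hoy (conn_trans hox h)
        have hxz : ω ∈ (openConn x z : Set (BondConfig (Fin n))) := by
          by_contra hxz
          exact hnU₂ ⟨⟨⟨hxy, hxz⟩, hox⟩, hzb⟩
        refine ⟨⟨conn_trans hox (conn_trans hxz hzb), hoA'⟩, ?_⟩
        simp only [mem_union, not_or]
        exact ⟨fun h => hoy h.1, fun h => h.1.1.2 hxz⟩
      · -- `o ↮ x`, `o ↮ y`: then `o ↔ z`, so `o ↔ b`
        have hoz : ω ∈ (openConn o z : Set (BondConfig (Fin n))) := by
          rcases hoA' with (h | h) | h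
          · exact absurd h hox
          · exact absurd h hoy
          · exact h
        refine ⟨⟨conn_trans hoz hzb, hoA'⟩, ?_⟩
        simp only [mem_union, not_or]
        exact ⟨fun h => hoy h.1, fun h => hox h.1.2⟩
  -- measure bookkeeping
  have hmS : MeasurableSet (S₂ ∪ U₂) := MeasurableSet.of_discrete
  have hmS' : MeasurableSet (S₁ ∪ U₁) := MeasurableSet.of_discrete
  have ez : μ.real Lz = μ.real S₂ + μ.real U₂ + μ.real (Lz \ (S₂ ∪ U₂)) := by
    have h1 := measureReal_inter_add_sdiff (μ := μ) (s := Lz) hmS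
    rw [inter_eq_right.2 (union_subset hS₂Lz hU₂Lz), measureReal_union hdisj₂ MeasurableSet.of_discrete]
      at h1
    linarith
  have eo : μ.real Lo = μ.real S₁ + μ.real U₁ + μ.real (Lo \ (S₁ ∪ U₁)) := by
    have h1 := measureReal_inter_add_sdiff (μ := μ) (s := Lo) hmS'
    rw [inter_eq_right.2 (union_subset hS₁Lo hU₁Lo), measureReal_union hdisj₁ MeasurableSet.of_discrete]
      at h1
    linarith
  have hmono : μ.real (Lz \ (S₂ ∪ U₂)) ≤ μ.real (Lo \ (S₁ ∪ U₁)) := measureReal_mono hrest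
  linarith

/-! ### The Lemma-3 bracket -/

/-- **The `y`-bracket is nonnegative** (Kozma–Nitzan Lemma 3(i) with `a₁ = z`, `a₂ = y`, `Q = {o ↔ y}`, which is
increasing in the open edge cluster of `y`): if `μ(z↔b) ≤ μ(y↔b)` then
`μ({o↔y} ∩ ({z↔b} ∖ {y↔b})) ≤ μ({o↔y} ∩ ({y↔b} ∖ {z↔b}))`.
[cite: KozmaNitzan2024, Lemma 3(i) (pp. 6–7)] -/
theorem q7Three_lemma3 (w : Sym2 (Fin n) → unitInterval) (o b y z : Fin n)
    (hyz : (prodBernoulli w).real (openConn z b) ≤ (prodBernoulli w).real (openConn y b)) :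
    (prodBernoulli w).real (openConn o y ∩ (openConn z b \ openConn y b)) ≤
      (prodBernoulli w).real (openConn o y ∩ (openConn y b \ openConn z b)) := by
  set μ := prodBernoulli w with hμ
  have hQ : ∀ ω ω', ω ∈ (openConn y o : Set (BondConfig (Fin n))) →
      openEdgeCluster ω y ⊆ openEdgeCluster ω' y → ω' ∈ (openConn y o : Set (BondConfig (Fin n))) :=
    pivDom_openConn_mono_openEdgeCluster y o
  have key := knLemma3i n w z y b (openConn y o) 0 hQ le_rfl (by linarith)
  rw [zero_mul, add_zero] at key
  -- `{z↔b} ∩ Q = ({o↔y} ∩ ({z↔b} ∖ {y↔b})) ⊔ ({o↔y} ∩ {y↔b} ∩ {z↔b})`, and similarly for `y`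
  have hyo : (openConn y o : Set (BondConfig (Fin n))) = openConn o y := by
    ext η; exact ⟨fun h => SimpleGraph.Reachable.symm h, fun h => SimpleGraph.Reachable.symm h⟩
  rw [hyo] at key
  have ezb : μ.real (openConn z b ∩ openConn o y) =
      μ.real (openConn o y ∩ (openConn z b \ openConn y b)) +
        μ.real (openConn o y ∩ openConn y b ∩ openConn z b) := by
    rw [← measureReal_union _ MeasurableSet.of_discrete]
    · congr 1
      ext ω
      simp only [mem_inter_iff, mem_union, mem_sdiff]
      tauto
    · rw [Set.disjoint_left]
      rintro ω ⟨-, -, hyb⟩ ⟨⟨-, hyb'⟩, -⟩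
      exact hyb hyb'
  have eyb : μ.real (openConn y b ∩ openConn o y) =
      μ.real (openConn o y ∩ (openConn y b \ openConn z b)) +
        μ.real (openConn o y ∩ openConn y b ∩ openConn z b) := by
    rw [← measureReal_union _ MeasurableSet.of_discrete]
    · congr 1
      ext ω
      simp only [mem_inter_iff, mem_union, mem_sdiff]
      tauto
    · rw [Set.disjoint_left]
      rintro ω ⟨-, -, hzb⟩ ⟨⟨-, -⟩, hzb'⟩
      exact hzb hzb'
  linarith

/-! ### The BHK bracket (source `x`, set `{y, z}`) -/

/-- **van den Berg–Häggström–Kahn for the source `x` and the set `{y, z}`** (tree theorem `stub_bhkSets`,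
Thm 1.3 for the cluster of `x` given `D = {x ↮ {y,z}}` with `f = 1{x↔o}`, `g = 1{x↔b}`, and Thm 1.4 for the
clusters of `x` and of `{y, z}` with `f = 1{x↔o}`, `g = 1{z↔b}` — the latter read off the union edge cluster
`C_y ∪ C_z`, `mem_openConn_iff_of_cluster_subset`):
`μ(D ∩ {o↔x})·μ(D ∩ {x↔b}) ≤ μ(D)·μ(D ∩ {o↔x} ∩ {x↔b})` and
`μ(D)·μ(D ∩ {o↔x} ∩ {z↔b}) ≤ μ(D ∩ {o↔x})·μ(D ∩ {z↔b})`.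
[cite: VandenbergHaggstromKahn2005, Thms 1.3–1.4] -/
theorem q7Three_bhk (w : Sym2 (Fin n) → unitInterval) (o b x y z : Fin n) (hxy : x ≠ y) (hxz : x ≠ z) :
    (prodBernoulli w).real (((openConn x y)ᶜ ∩ (openConn x z)ᶜ) ∩ openConn o x) *
        (prodBernoulli w).real (((openConn x y)ᶜ ∩ (openConn x z)ᶜ) ∩ openConn x b) ≤
      (prodBernoulli w).real ((openConn x y)ᶜ ∩ (openConn x z)ᶜ) *
        (prodBernoulli w).real (((openConn x y)ᶜ ∩ (openConn x z)ᶜ) ∩ openConn o x ∩ openConn x b) ∧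
    (prodBernoulli w).real ((openConn x y)ᶜ ∩ (openConn x z)ᶜ) *
        (prodBernoulli w).real (((openConn x y)ᶜ ∩ (openConn x z)ᶜ) ∩ openConn o x ∩ openConn z b) ≤
      (prodBernoulli w).real (((openConn x y)ᶜ ∩ (openConn x z)ᶜ) ∩ openConn o x) *
        (prodBernoulli w).real (((openConn x y)ᶜ ∩ (openConn x z)ᶜ) ∩ openConn z b) := by
  set μ := prodBernoulli w with hμ
  set D : Set (BondConfig (Fin n)) := (openConn x y)ᶜ ∩ (openConn x z)ᶜ with hD
  obtain ⟨h13, h14⟩ := stub_bhkSets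
  set F : Set (Sym2 (Fin n)) → ℝ := (openConn x o : Set (BondConfig (Fin n))).indicator 1 with hF
  set G : Set (Sym2 (Fin n)) → ℝ := (openConn x b : Set (BondConfig (Fin n))).indicator 1 with hG
  set H : Set (Sym2 (Fin n)) → ℝ := (openConn z b : Set (BondConfig (Fin n))).indicator 1 with hH
  have hFm : Monotone F := monotone_indicator_of_isUpperSet (isUpperSet_openConn x o)
  have hGm : Monotone G := monotone_indicator_of_isUpperSet (isUpperSet_openConn x b)
  have hHm : Monotone H := monotone_indicator_of_isUpperSet (isUpperSet_openConn z b)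
  -- the conditioning sets
  have hD1 : {ω : BondConfig (Fin n) | ∀ s ∈ ({x} : Finset (Fin n)), ∀ t ∈ ({y, z} : Set (Fin n)),
      ¬ (openGraph ω).Reachable s t} = D := by
    ext ω
    simp only [mem_setOf_eq, Finset.mem_singleton, forall_eq, mem_insert_iff, mem_singleton_iff,
      forall_eq_or_imp, hD, mem_inter_iff, mem_compl_iff]
    rfl
  have hD2 : {ω : BondConfig (Fin n) | ∀ s ∈ ({x} : Finset (Fin n)), ∀ t ∈ ({y, z} : Finset (Fin n)),
      ¬ (openGraph ω).Reachable s t} = D := by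
    ext ω
    simp only [mem_setOf_eq, Finset.mem_singleton, forall_eq, Finset.mem_insert, forall_eq_or_imp, hD,
      mem_inter_iff, mem_compl_iff]
    rfl
  -- the clusters
  have hCx : ∀ ω : BondConfig (Fin n), (⋃ s ∈ ({x} : Finset (Fin n)), openEdgeCluster ω s) =
      openEdgeCluster ω x := fun ω => Finset.set_biUnion_singleton x _
  have hCyz : ∀ ω : BondConfig (Fin n), (⋃ s ∈ ({y, z} : Finset (Fin n)), openEdgeCluster ω s) =
      openEdgeCluster ω y ∪ openEdgeCluster ω z := by
    intro ω
    rw [Finset.set_biUnion_insert, Finset.set_biUnion_singleton]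
  -- pointwise identification of the integrands
  have eF : ∀ ω : BondConfig (Fin n), F (openEdgeCluster ω x) =
      (openConn o x : Set (BondConfig (Fin n))).indicator 1 ω := by
    intro ω
    have hxo : (openConn x o : Set (BondConfig (Fin n))) = openConn o x := by
      ext η; exact ⟨fun h => SimpleGraph.Reachable.symm h, fun h => SimpleGraph.Reachable.symm h⟩
    rw [hF, indicator_openConn_of_cluster_subset subset_rfl (openEdgeCluster_subset ω x), hxo]
  have eG : ∀ ω : BondConfig (Fin n), G (openEdgeCluster ω x) =
      (openConn x b : Set (BondConfig (Fin n))).indicator 1 ω := fun ω =>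
    indicator_openConn_of_cluster_subset subset_rfl (openEdgeCluster_subset ω x)
  have eH : ∀ ω : BondConfig (Fin n), H (openEdgeCluster ω y ∪ openEdgeCluster ω z) =
      (openConn z b : Set (BondConfig (Fin n))).indicator 1 ω := fun ω =>
    indicator_openConn_of_cluster_subset subset_union_right
      (union_subset (openEdgeCluster_subset ω y) (openEdgeCluster_subset ω z))
  have eFG : ∀ ω : BondConfig (Fin n), F (openEdgeCluster ω x) * G (openEdgeCluster ω x) =
      (openConn o x ∩ openConn x b : Set (BondConfig (Fin n))).indicator 1 ω := by
    intro ω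
    rw [eF, eG]
    exact (congrFun (inter_indicator_one (s := (openConn o x : Set (BondConfig (Fin n))))
      (t := openConn x b) (M₀ := ℝ)) ω).symm
  have eFH : ∀ ω : BondConfig (Fin n),
      F (openEdgeCluster ω x) * H (openEdgeCluster ω y ∪ openEdgeCluster ω z) =
      (openConn o x ∩ openConn z b : Set (BondConfig (Fin n))).indicator 1 ω := by
    intro ω
    rw [eF, eH]
    exact (congrFun (inter_indicator_one (s := (openConn o x : Set (BondConfig (Fin n))))
      (t := openConn z b) (M₀ := ℝ)) ω).symm
  refine ⟨?_, ?_⟩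
  · have key := h13 n w {x} ({y, z} : Set (Fin n)) F G hFm hGm (by
      intro s hs
      rw [Finset.mem_singleton] at hs
      subst hs
      simp only [mem_insert_iff, mem_singleton_iff, not_or]
      exact ⟨hxy, hxz⟩)
    simp only [hD1, hCx] at key
    simp only [eFG] at key
    simp only [eF, eG, setIntegral_indicator_one_eq] at key
    simpa only [inter_assoc] using key
  · have key := h14 n w {x} {y, z} F H hFm hHm (by
      simp only [Finset.disjoint_singleton_left, Finset.mem_insert, Finset.mem_singleton, not_or]
      exact ⟨hxy, hxz⟩)
    simp only [hD2, hCx, hCyz] at key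
    simp only [eFH] at key
    simp only [eF, eH, setIntegral_indicator_one_eq] at key
    simpa only [inter_assoc] using key

/-! ### Registered stub form of the decomposition -/

/-- Registered stub form of `q7Three_decomp` (explicit `∀ n`, fully qualified).
[cite: KozmaNitzan2024, Question 7 (p. 36)] -/
theorem stub_q7ThreeDecomp : ∀ (n : ℕ) (w : Sym2 (Fin n) → unitInterval) (o b x y z : Fin n), ((Literature.Probability.LatticeModels.prodBernoulli w).real (Literature.Probability.Percolation.openConn o y ∩ (Literature.Probability.Percolation.openConn y b \ Literature.Probability.Percolation.openConn z b)) - (Literature.Probability.LatticeModels.prodBernoulli w).real (Literature.Probability.Percolation.openConn o y ∩ (Literature.Probability.Percolation.openConn z b \ Literature.Probability.Percolation.openConn y b))) + ((Literature.Probability.LatticeModels.prodBernoulli w).real (((Literature.Probability.Percolation.openConn x y)ᶜ ∩ (Literature.Probability.Percolation.openConn x z)ᶜ) ∩ Literature.Probability.Percolation.openConn o x ∩ Literature.Probability.Percolation.openConn x b) - (Literature.Probability.LatticeModels.prodBernoulli w).real (((Literature.Probability.Percolation.openConn x y)ᶜ ∩ (Literature.Probability.Percolation.openConn x z)ᶜ)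 ∩ Literature.Probability.Percolation.openConn o x ∩ Literature.Probability.Percolation.openConn z b)) ≤ (Literature.Probability.LatticeModels.prodBernoulli w).real (Literature.Probability.Percolation.openConn o b ∩ (Literature.Probability.Percolation.openConn o x ∪ Literature.Probability.Percolation.openConn o y ∪ Literature.Probability.Percolation.openConn o z)) - (Literature.Probability.LatticeModels.prodBernoulli w).real (Literature.Probability.Percolation.openConn z b ∩ (Literature.Probability.Percolation.openConn o x ∪ Literature.Probability.Percolation.openConn o y ∪ Literature.Probability.Percolation.openConn o z)) :=
  fun _ w o b x y z => q7Three_decomp w o b x y z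

end

end Summit.CriticalPhenomena.PercolationContinuityZ3.Theorems
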